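import Summits.RiemannHypothesis.RiemannHypothesis.Theses.SpectralTrace
import Summits.RiemannHypothesis.RiemannHypothesis.Theorems.SpectralIsHpSpectrum.Negative.RefutationImpliesRH
import Summits.RiemannHypothesis.RiemannHypothesis.Theorems.WindowTraceArch.Negative.ComplexSpectrum
import Summits.RiemannHypothesis.RiemannHypothesis.Theorems.WindowTraceArch.Negative.LocalWeylTools
import Summits.RiemannHypothesis.RiemannHypothesis.Theorems.WindowTraceArch.Negative.BoundedDensity
import Literature.NumberTheory.LFunctions.WeilExplicitProofs
import Literature.NumberTheory.LFunctions.WeilExplicitRightEdge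
import Literature.NumberTheory.LFunctions.WeilArchimedeanPositivityProofs
import Literature.NumberTheory.LFunctions.SimpleZeros
import Literature.NumberTheory.LFunctions.WeilMellinBounds
import Mathlib.MeasureTheory.Integral.RieszMarkovKakutani.Real

/-!
# Line `test-algebra-stone-weierstrass` — skeleton for crux `SpectralIsHpSpectrum` (stmt-RiemannHypothesis-0195)

Crux (route `SpectralTrace`, rank 5, auto-crux; decl
`Summit.RiemannHypothesis.RiemannHypothesis.Theses.SpectralTrace.SpectralIsHpSpectrum`):
every REAL family `γ : ι → ℝ` with `HasSum (i ↦ ĝ(1/2 + iγ_i)) (W g)` for all Weil tests `g` has,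
over every `z : ℂ`, fibre count `{i | 1/2 + iγ_i = z}.encard` equal to the multiplicity of `z` as a
non-trivial zero of `ζ` (`𝟙_{nontrivial zeros}(z) · analyticOrderNatAt ζ z`, read in `ℕ∞`).

LINE (idea card `Ideas/test-algebra-stone-weierstrass.md`, line card `Lines/test-algebra-stone-weierstrass.md`,
triage r1 k1–k3: pass × 3; skeleton gen 1 by planner-cruxplan-…-test-algebra-stone-w-0, RECUT gen 2 by
planner-cruxplan-…-test-algebra-stone-w-g2-0). The critical-line transforms `u ↦ ĝ(1/2+iu)` of Weil tests form a
conjugation-closed ALGEBRA `𝒜` (`(g ⋆ h)^ = ĝ ĥ`, `(g̃)^ = conj ĝ` on the line, `(g + h)^ = ĝ + ĥ`,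
`(c g)^ = c ĝ`) of functions vanishing at infinity that separates points and vanishes identically
nowhere — ALL of this is PROVED below from tree lemmas. With `1` adjoined and everything extended by
`0` to the one-point compactification, Stone–Weierstrass makes `ℂ·1 ⊕ 𝒜` uniformly dense in
`C(OnePoint ℝ, ℂ) ⊇ C_c(ℝ, ℂ)`. Two real spectra `γ, γ'` of ONE functional `L` give, after tilting by
the weight `|k̂(1/2+i·)|²` of a fixed test `k`, two FINITE atomic measures with the same mass
`Re L(k ⋆ k̃)` and the same integral `L(g ⋆ k ⋆ k̃)` against every element of `𝒜`; density makes them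
agree on `C_c`, hence as measures, and the atom at `x` reads `|k̂(1/2+ix)|² · #{i | γ_i = x}` with
`k̂(1/2+ix) ≠ 0` for a modulated bump. So two real spectra of the same functional have the same
multiplicities (`RealSpectrumUnique`, the W-free transfer `C⁺` of the card); applied to `L = W`, `γ` =
the trace family and `γ'` = the ordinates of the non-trivial zeros under RH (RH itself comes from the
hypothesis: landed `riemannHypothesis_of_trace`), this is the crux.

The three REGISTERED STUBS (the only `sorry`s; sizes are guesses; each is stated over existing
Literature/Mathlib declarations plus the data definitions `IsRealSpectrumFor`, `atomicMeasure`,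
`spectralWeight`, `weightedSpectralMeasure` below, so each can land verbatim as a `--supports` helper):

* `stub_pairing`          [= `Pairing`] (M) — the tilted spectral measure of a real spectrum is finite with
  mass `Re L(k ⋆ k̃)` and pairs every Weil transform to `L(g ⋆ (k ⋆ k̃))` (consumes the VALUE `L g`);
  UNCHANGED from gen 1;
* `stub_stoneWeierstrass` [= `StoneWeierstrassC0`] (M–L, HARDEST) — Weil-FREE locally compact
  Stone–Weierstrass with constants on `ℝ`: a set `A` of `C₀` functions `ℝ → ℂ` closed under `+`, `ℂ•`,
  `*`, `star`, separating points and vanishing identically nowhere approximates every `F ∈ C_c(ℝ, ℂ)`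
  uniformly on `ℝ` by `c + f`, `f ∈ A` (gen 2 RECUT of gen 1's `stub_density`: the Weil-specific algebra
  facts are now PROVED glue, `density_of_stoneWeierstrass`, and only the topological packaging is stubbed);
* `stub_measureExt`       [= `MeasureExt`] (M) — given that density for `𝒜`, finite measures on `ℝ` with
  equal mass and equal integrals of all Weil transforms are equal (uniform approximation under the
  integral, then `C_c` determines finite Borel measures on `ℝ`: Mathlib
  `Measure.ext_of_integral_eq_on_compactlySupported`, engine example below); UNCHANGED from gen 1.

`SpectralIsHpSpectrum_of : Pairing → StoneWeierstrassC0 → MeasureExt → SpectralIsHpSpectrum` (hypotheses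
keyed `Registered.stub_*`) is the sorry-FREE kernel-checked composition concluding the crux BY NAME
(`#print axioms` = propext, Classical.choice, Quot.sound); the wiring `example` feeds it the three stubs.
All glue is PROVED here: continuity + vanishing at infinity of the transforms
(`lineTransform_continuous_tendsto_zero`), SEPARATION OF POINTS (`separation`: a narrow real bump modulated
to `x`; `Re(ĥ(1/2) − ĥ(1/2+iv)) = ∫ h (1 − cos vt) > 0`), non-vanishing at a prescribed point
(`exists_isWeilTest_weilMellin_ne_zero`), the *-ALGEBRA CLOSURE of `𝒜` and the instantiation of the
abstract Stone–Weierstrass stub (`density_of_stoneWeierstrass`), the atom read-out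
(`atomicMeasure_apply_singleton`), `RealSpectrumUnique` from the three statements
(`realSpectrumUnique_of_line`), and the reduction `RealSpectrumUnique → crux`
(`encard_fibre_eq_of_realSpectrumUnique`: RH from the hypothesis, off-line fibres empty, on-line count of
the canonical family `zetaOrdinates` = `analyticOrderNatAt ζ`; this is the standing disprover's §2
`spectralIsHpSpectrum_iff_ordinate_count` specialised to the direction we need — credit:
`Cruxes/SpectralIsHpSpectrum/Disproof.lean`, refuter-cdisprove; and the ideator's `SketchIdeator1.lean`
for `zetaOrdinates` / the Σ-fibre count; the Disproof module is deliberately NOT imported, since a later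
cdisprove round may rewrite that workfile).

Disproof.lean honoured: §3 `spectralIsHpSpectrum_false_without_value` — the value `L g` is consumed in
`stub_pairing` (mass AND pairing are values of `L`; summability alone gives no comparison); §3
`spectralIsHpSpectrum_false_on_window_of_nonpos` / §5 windows — `𝒜` is an algebra only because supports
grow under `⋆` (`supp (g ⋆ k ⋆ k̃) = supp g + supp k − supp k`), so the all-tests hypothesis is used and
nothing is claimed on a window; §3 "integrality not load-bearing — prove the weighted MEASURE statement":
`stub_measureExt` is exactly that; §3 "do not generalise to complex spectra": conj-closure
`(g̃)^(1/2+iu) = conj ĝ(1/2+iu)` is used ON THE LINE only (`weilMellin_weilReflect_half`, now consumed by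
`density_of_stoneWeierstrass`); §1 `riemannHypothesis_of_trace` (landed,
`Theorems/SpectralIsHpSpectrum/Negative/RefutationImpliesRH.lean`) is imported and used in the reduction;
no stub is an instance of a landed Negative lemma (the three landed negatives concern the
Summable-weakening, the `A ≤ 0` window and the all-zeros variant; `stub_stoneWeierstrass` does not
mention `W`, `ζ` or Weil tests at all).
-/

noncomputable section

set_option linter.dupNamespace false

open Complex Set MeasureTheory Filter Topology
open scoped Real ENNReal

namespace Summit.RiemannHypothesis.RiemannHypothesis.Cruxes.SpectralIsHpSpectrum.TestAlgebraStoneWeierstrass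

open Literature.NumberTheory.LFunctions
open Summit.RiemannHypothesis.RiemannHypothesis.Theses.SpectralTrace (SpectralIsHpSpectrum)
open Summit.RiemannHypothesis.RiemannHypothesis.Theorems.WindowTraceArch.Negative
open Summit.RiemannHypothesis.RiemannHypothesis.Theorems.SpectralIsHpSpectrum.Negative
  (riemannHypothesis_of_trace)

/-! ## Data definitions (W-free vocabulary of the line; unchanged from gen 1) -/

/-- `γ` is a real spectrum of the functional `L`: `Σ_i ĝ(1/2 + iγ_i) = L g` (`HasSum`) on every Weil
test `g`. The hypothesis of the crux is `IsRealSpectrumFor γ weilFunctional` (definitionally). -/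
def IsRealSpectrumFor {ι : Type*} (γ : ι → ℝ) (L : (ℝ → ℂ) → ℂ) : Prop :=
  ∀ g : ℝ → ℂ, IsWeilTest g → HasSum (fun i => weilMellin g (1 / 2 + (γ i : ℂ) * I)) (L g)

/-- TRANSFER `C⁺` of the card (W-free): two real spectra of the SAME functional have the same
multiplicities at every real point. -/
def RealSpectrumUnique : Prop :=
  ∀ (ι ι' : Type) (γ : ι → ℝ) (γ' : ι' → ℝ) (L : (ℝ → ℂ) → ℂ),
    IsRealSpectrumFor γ L → IsRealSpectrumFor γ' L →
      ∀ x : ℝ, {i | γ i = x}.encard = {j | γ' j = x}.encard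

/-- The atomic measure `Σ_i w(γ_i) δ_{γ_i}` on `ℝ` (arbitrary index type; `Measure.sum` needs no
countability). -/
def atomicMeasure {ι : Type*} (γ : ι → ℝ) (w : ℝ → ℝ≥0∞) : Measure ℝ :=
  Measure.sum fun i => w (γ i) • Measure.dirac (γ i)

/-- The spectral weight `|k̂(1/2 + iu)|²` of a test `k`, in `ℝ≥0∞`. -/
def spectralWeight (k : ℝ → ℂ) (u : ℝ) : ℝ≥0∞ :=
  ENNReal.ofReal (‖weilMellin k (1 / 2 + u * I)‖ ^ 2)

/-- The TILTED spectral measure `ν_{γ,k} = Σ_i |k̂(1/2 + iγ_i)|² δ_{γ_i}`. -/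
def weightedSpectralMeasure {ι : Type*} (γ : ι → ℝ) (k : ℝ → ℂ) : Measure ℝ :=
  atomicMeasure γ (spectralWeight k)

/-- The critical-line test algebra `𝒜 = {u ↦ ĝ(1/2 + iu) | g a Weil test}` as a set of functions. -/
def lineAlgebra : Set (ℝ → ℂ) :=
  {f | ∃ g : ℝ → ℂ, IsWeilTest g ∧ f = fun u : ℝ => weilMellin g (1 / 2 + u * I)}

/-! ## The statements of the line (named `Prop`s; each IS its registered stub, definitionally) -/

/-- **Statement 1 [Pairing]** — mass and pairing of the tilted spectral measure of a real spectrum. -/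
def Pairing : Prop :=
  ∀ (ι : Type) (γ : ι → ℝ) (L : (ℝ → ℂ) → ℂ), IsRealSpectrumFor γ L →
    ∀ k : ℝ → ℂ, IsWeilTest k →
      weightedSpectralMeasure γ k Set.univ =
          ENNReal.ofReal (L (weilConv k (weilReflect k))).re ∧
      ∀ g : ℝ → ℂ, IsWeilTest g →
        ∫ u, weilMellin g (1 / 2 + u * I) ∂(weightedSpectralMeasure γ k) =
          L (weilConv g (weilConv k (weilReflect k)))

/-- **Statement 2 [StoneWeierstrassC0]** — Weil-free locally compact Stone–Weierstrass with constants
on `ℝ`: a `+`/`ℂ•`/`*`/`star`-closed set `A` of `C₀` functions that separates points and vanishes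
identically nowhere approximates every continuous compactly supported `F` uniformly by `c + f`, `f ∈ A`. -/
def StoneWeierstrassC0 : Prop :=
  ∀ A : Set (ℝ → ℂ),
    (∀ f ∈ A, Continuous f ∧ Tendsto f (cocompact ℝ) (𝓝 0)) →
    (∀ f ∈ A, ∀ g ∈ A, f + g ∈ A) →
    (∀ (c : ℂ), ∀ f ∈ A, c • f ∈ A) →
    (∀ f ∈ A, ∀ g ∈ A, f * g ∈ A) →
    (∀ f ∈ A, star f ∈ A) →
    (∀ x y : ℝ, x ≠ y → ∃ f ∈ A, f x ≠ f y) →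
    (∀ x : ℝ, ∃ f ∈ A, f x ≠ 0) →
    ∀ F : ℝ → ℂ, Continuous F → HasCompactSupport F → ∀ ε : ℝ, 0 < ε →
      ∃ (c : ℂ), ∃ f ∈ A, ∀ u : ℝ, ‖F u - (c + f u)‖ ≤ ε

/-- The Weil-specific DENSITY statement (gen 1's `stub_density` conclusion; now DERIVED from
`StoneWeierstrassC0` by `density_of_stoneWeierstrass`): every `F ∈ C_c(ℝ, ℂ)` is uniformly within `ε`
of `u ↦ c + ĝ(1/2+iu)` for some constant `c` and Weil test `g`. -/
def Density : Prop :=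
  ∀ F : ℝ → ℂ, Continuous F → HasCompactSupport F → ∀ ε : ℝ, 0 < ε →
    ∃ (c : ℂ) (g : ℝ → ℂ), IsWeilTest g ∧
      ∀ u : ℝ, ‖F u - (c + weilMellin g (1 / 2 + u * I))‖ ≤ ε

/-- **Statement 3 [MeasureExt]** — given `Density`, finite measures on `ℝ` are determined by mass +
Weil-transform integrals. -/
def MeasureExt : Prop :=
  Density →
    ∀ (μ ν : Measure ℝ) [IsFiniteMeasure μ] [IsFiniteMeasure ν], μ Set.univ = ν Set.univ →
      (∀ g : ℝ → ℂ, IsWeilTest g →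
        ∫ u, weilMellin g (1 / 2 + u * I) ∂μ = ∫ u, weilMellin g (1 / 2 + u * I) ∂ν) →
      μ = ν

/-! ## The three registered stubs (the only `sorry`s of the file) -/

/-- STUB 1 [Pairing] (M; unchanged from gen 1) — **mass and pairing of the tilted spectral measure.** For
a real spectrum `γ` of `L` and Weil tests `k`, `g`: (a) `ν_{γ,k}(ℝ) = Re L(k ⋆ k̃)` — from
`HasSum (i ↦ (k ⋆ k̃)^(1/2+iγ_i)) (L(k ⋆ k̃))` with `(k ⋆ k̃)^(1/2+iu) = |k̂(1/2+iu)|²`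
(`weilMellin_weilConv_weilReflect_half`), `Complex.reCLM`/`Complex.hasSum_re` and
`ENNReal.ofReal_tsum_of_nonneg` (`Measure.sum_apply`, `dirac univ = 1`); in particular `ν` is FINITE;
(b) `∫ ĝ(1/2+iu) dν(u) = L(g ⋆ (k ⋆ k̃))` — `u ↦ ĝ(1/2+iu)` is bounded (`norm_weilMellin_le_sq`) and
continuous (`hasDerivAt_weilMellin_line`), hence integrable for the finite `Measure.sum`;
`hasSum_integral_measure` (no `Countable ι` needed, SumMeasure.lean) + `integral_smul_measure` +
`integral_dirac` give `Σ_i |k̂|²(γ_i) ĝ(γ_i)`, which is `Σ_i (g ⋆ (k ⋆ k̃))^(1/2+iγ_i)` termwise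
(`weilMellin_weilConv_holds`, `IsWeilTest.weilConv`, `IsWeilTest.weilReflect`) `= L(g ⋆ (k ⋆ k̃))` by the
spectrum hypothesis and `HasSum.unique`. This stub is where the VALUE `L g` is consumed (Disproof §3
`spectralIsHpSpectrum_false_without_value`). Degenerate check: `ι` empty forces `L = 0` on tests; both
sides `0`. Sources: card test-algebra-stone-weierstrass; Disproof.lean §2 blueprint; Katznelson,
Introduction to Harmonic Analysis VI.2 (book:katznelson2004-introduction-harmonic-analysis p.160). -/
theorem stub_pairing :
    ∀ (ι : Type) (γ : ι → ℝ) (L : (ℝ → ℂ) → ℂ), IsRealSpectrumFor γ L →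
      ∀ k : ℝ → ℂ, IsWeilTest k →
        weightedSpectralMeasure γ k Set.univ =
            ENNReal.ofReal (L (weilConv k (weilReflect k))).re ∧
        ∀ g : ℝ → ℂ, IsWeilTest g →
          ∫ u, weilMellin g (1 / 2 + u * I) ∂(weightedSpectralMeasure γ k) =
            L (weilConv g (weilConv k (weilReflect k))) := by
  sorry

/-- STUB 2 [StoneWeierstrassC0] (M–L, HARDEST; gen 2 recut of gen 1's `stub_density`) — **locally compact
Stone–Weierstrass with constants on `ℝ`, Weil-free.** For a set `A` of functions `ℝ → ℂ` that are
continuous and tend to `0` along `cocompact ℝ`, closed under `+`, `ℂ•`, `*` and `star` (pointwise `conj`),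
separating points and with no common zero, every continuous compactly supported `F` is, for every
`ε > 0`, uniformly within `ε` of `c + f` for some constant `c` and some `f ∈ A`. Route: extend each
`f ∈ A` by `0` to `OnePoint ℝ` (`OnePoint.continuousMapMk` from the `C₀` facts via
`Filter.coclosedCompact_eq_cocompact` — engine example below); the set `{c • 1 + ext f | c : ℂ, f ∈ A}` is
(the carrier of) a unital STAR SUBALGEBRA of `C(OnePoint ℝ, ℂ)` (`0 ∈ A` as `0 • f`; sums/scalars/products/
star by the closure hypotheses: `(c + f)(d + g) = cd + (c g + d f + f g)`, `star (c + f) = conj c + star f`,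
and `ext` is additive and multiplicative because `0 + 0 = 0·0 = conj 0 = 0`); it separates the points of
`OnePoint ℝ` (two reals by hypothesis, a real from `∞` by the no-common-zero hypothesis), so
`ContinuousMap.starSubalgebra_topologicalClosure_eq_top_of_separatesPoints` (engine example below) makes it
dense; `F` extended by `0 = F(∞)` is continuous on `OnePoint ℝ` (compact support ⇒ `F → 0` along
`cocompact`), and an element within `ε` in sup norm (`StarSubalgebra.mem_topologicalClosure` /
`Metric.mem_closure_iff`, `ContinuousMap.dist_apply_le_dist`) restricts to the claimed pointwise bound on
`ℝ`. Equivalently `StarAlgebra.adjoin ℂ (ext '' A)` + `adjoin_induction`. Mathlib has only the compact and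
the on-a-compact-subset real versions (`exists_mem_subalgebra_near_continuous_of_isCompact_of_separatesPoints`),
not this `C₀` form — hence a genuine M–L stub, but with NO Weil-side side conditions left in it.
Sources: card (Lever, First lemma); Mathlib `Topology/ContinuousMap/StoneWeierstrass.lean`; Katznelson
VI.2.2 (uniqueness from a separating algebra); Conway, A Course in Functional Analysis V.8 (C₀ SW). -/
theorem stub_stoneWeierstrass :
    ∀ A : Set (ℝ → ℂ),
      (∀ f ∈ A, Continuous f ∧ Tendsto f (cocompact ℝ) (𝓝 0)) →
      (∀ f ∈ A, ∀ g ∈ A, f + g ∈ A) →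
      (∀ (c : ℂ), ∀ f ∈ A, c • f ∈ A) →
      (∀ f ∈ A, ∀ g ∈ A, f * g ∈ A) →
      (∀ f ∈ A, star f ∈ A) →
      (∀ x y : ℝ, x ≠ y → ∃ f ∈ A, f x ≠ f y) →
      (∀ x : ℝ, ∃ f ∈ A, f x ≠ 0) →
      ∀ F : ℝ → ℂ, Continuous F → HasCompactSupport F → ∀ ε : ℝ, 0 < ε →
        ∃ (c : ℂ), ∃ f ∈ A, ∀ u : ℝ, ‖F u - (c + f u)‖ ≤ ε := by
  sorry

/-- STUB 3 [Density → MeasureExt] (M; unchanged from gen 1) — **finite measures are determined by mass +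
Weil-transform integrals.** Given the density statement (`Density`, derived from STUB 2 in this file),
two finite Borel measures `μ, ν` on `ℝ` with `μ(ℝ) = ν(ℝ)` and `∫ ĝ(1/2+iu) dμ = ∫ ĝ(1/2+iu) dν` for
every Weil test `g` are equal. Route: (1) each `u ↦ ĝ(1/2+iu)` is bounded and continuous
(`lineTransform_continuous_tendsto_zero` below), hence integrable for finite measures (so the hypothesis
is about genuine integrals); (2) for `F ∈ C_c(ℝ, ℂ)` and `ε > 0` pick `c, g` from density: then
`|∫F dμ − ∫F dν| ≤ |∫(F − c − ĝ) dμ| + |c μ(ℝ) + ∫ĝ dμ − c ν(ℝ) − ∫ĝ dν| + |∫(c + ĝ − F) dν| ≤ 2 ε μ(ℝ)`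
(middle term `0` by equal mass + hypothesis; `norm_integral_le_of_norm_le_const`), so `∫F dμ = ∫F dν` on
all of `C_c(ℝ, ℂ)`, in particular on real-valued `f : C_c(ℝ, ℝ)` (`integral_ofReal`); (3) Mathlib's
`MeasureTheory.Measure.ext_of_integral_eq_on_compactlySupported` (finite measures on `ℝ` are `Regular`;
engine example below) concludes — alternatively truncation + dominated convergence +
`ext_of_forall_integral_eq_of_IsFiniteMeasure`. The hypothesis `μ(ℝ) = ν(ℝ)` is free at the call site
(both masses are `Re L(k ⋆ k̃)` by STUB 1) and is what the adjoined unit needs; triage r1-1/2/3 note it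
is even redundant (Fubini/charFun route: `∫ĝ dμ = ∫ g · charFun μ`, `Measure.ext_of_charFun`), which a
prover may exploit — any proof closes the stub. Sources: card (First lemma `measure_ext_of_weilTests`);
Mathlib `MeasureTheory/Integral/RieszMarkovKakutani/Real.lean`, `MeasureTheory/Measure/HasOuterApproxClosed.lean`;
Billingsley, Convergence of Probability Measures Thm 1.2. -/
theorem stub_measureExt :
    (∀ F : ℝ → ℂ, Continuous F → HasCompactSupport F → ∀ ε : ℝ, 0 < ε →
      ∃ (c : ℂ) (g : ℝ → ℂ), IsWeilTest g ∧
        ∀ u : ℝ, ‖F u - (c + weilMellin g (1 / 2 + u * I))‖ ≤ ε) →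
    ∀ (μ ν : Measure ℝ) [IsFiniteMeasure μ] [IsFiniteMeasure ν], μ Set.univ = ν Set.univ →
      (∀ g : ℝ → ℂ, IsWeilTest g →
        ∫ u, weilMellin g (1 / 2 + u * I) ∂μ = ∫ u, weilMellin g (1 / 2 + u * I) ∂ν) →
      μ = ν := by
  sorry

/-! ### Consistency: each named statement IS its registered stub (definitionally) -/

theorem pairing_holds : Pairing := stub_pairing
theorem stoneWeierstrassC0_holds : StoneWeierstrassC0 := stub_stoneWeierstrass
theorem measureExt_holds : MeasureExt := stub_measureExt

/-! ### Name-keyed aliases of the three statements (the hypotheses of the composition; the skeleton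
audit admits a hypothesis only if its head constant is a registered obligation or is named like a
declared stub) -/
namespace Registered

/-- Alias of `Pairing` keyed by the registered stub name. -/
abbrev stub_pairing : Prop := Pairing
/-- Alias of `StoneWeierstrassC0` keyed by the registered stub name. -/
abbrev stub_stoneWeierstrass : Prop := StoneWeierstrassC0
/-- Alias of `MeasureExt` keyed by the registered stub name. -/
abbrev stub_measureExt : Prop := MeasureExt

end Registered

/-! ## Sorry-free glue, I: the analytic inputs of Stone–Weierstrass -/

/-- Reflection is conjugation ON THE CRITICAL LINE: `(g̃)^(1/2+iu) = conj ĝ(1/2+iu)` (from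
`weilMellin_weilReflect_holds : (g̃)^(s) = conj ĝ(1 - conj s)` and `1 - conj (1/2+iu) = 1/2+iu`): the
star-closure of `𝒜`; off the line it fails (Disproof §3: no complex spectra). -/
theorem weilMellin_weilReflect_half (g : ℝ → ℂ) (u : ℝ) :
    weilMellin (weilReflect g) (1 / 2 + u * I) = (starRingEnd ℂ) (weilMellin g (1 / 2 + u * I)) := by
  have h := weilMellin_weilReflect_holds g (1 / 2 + u * I)
  rw [h]
  congr 2
  apply Complex.ext <;> norm_num

/-- **`C₀` facts**: every Weil transform restricted to the critical line is continuous
(`hasDerivAt_weilMellin_line`) and tends to `0` at infinity (`|ĝ(1/2+iu)| ≤ C/(1+u²)²`,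
`norm_weilMellin_le_sq`). -/
theorem lineTransform_continuous_tendsto_zero :
    ∀ g : ℝ → ℂ, IsWeilTest g →
      Continuous (fun u : ℝ => weilMellin g (1 / 2 + u * I)) ∧
      Tendsto (fun u : ℝ => weilMellin g (1 / 2 + u * I)) (cocompact ℝ) (𝓝 0) := by
  intro g hg
  refine ⟨continuous_iff_continuousAt.2 fun u => (hasDerivAt_weilMellin_line hg u).continuousAt, ?_⟩
  have hb : ∀ u : ℝ, ‖weilMellin g (1 / 2 + u * I)‖ ≤ weilDecayW2 0 g / (1 + u ^ 2) ^ 2 := by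
    intro u
    have him : ((1 / 2 : ℂ) + u * I).im = u := by simp
    have h := norm_weilMellin_le_sq hg (A := 0) (s := 1 / 2 + u * I) (by simp)
    rw [him] at h
    exact h
  refine squeeze_zero_norm' (Eventually.of_forall hb) ?_
  have h1 : Tendsto (fun u : ℝ => (1 + u ^ 2) ^ 2) (cocompact ℝ) atTop := by
    have hn : Tendsto (fun u : ℝ => ‖u‖ ^ 2) (cocompact ℝ) atTop :=
      (tendsto_pow_atTop two_ne_zero).comp tendsto_norm_cocompact_atTop
    have h2 : Tendsto (fun u : ℝ => 1 + u ^ 2) (cocompact ℝ) atTop := by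
      refine tendsto_atTop_add_const_left _ 1 ?_
      simpa only [Real.norm_eq_abs, sq_abs] using hn
    exact (tendsto_pow_atTop two_ne_zero).comp h2
  have h3 := h1.inv_tendsto_atTop.const_mul (weilDecayW2 0 g)
  rw [mul_zero] at h3
  refine h3.congr fun u => ?_
  simp [div_eq_mul_inv]

/-- **Non-vanishing at a prescribed point**: for every real `x` some Weil test has `k̂(1/2+ix) ≠ 0`
(a narrow bump `h` with `|ĥ(1/2+iv)|² ≥ c > 0` for `|v| ≤ 1`, `exists_bump_lower`, modulated to `x`,
`weilMellin_modulate`). No-common-zero input of Stone–Weierstrass and the choice of the tilt `k`. -/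
theorem exists_isWeilTest_weilMellin_ne_zero :
    ∀ x : ℝ, ∃ g : ℝ → ℂ, IsWeilTest g ∧ weilMellin g (1 / 2 + x * I) ≠ 0 := by
  intro x
  obtain ⟨h, hh, -, -, c, hc, hlow⟩ := exists_bump_lower (δ := 1 / 2) (by norm_num) le_rfl
  refine ⟨fun t => cexp (-((x * t : ℝ) : ℂ) * I) * h t, isWeilTest_modulate hh x, ?_⟩
  rw [weilMellin_modulate]
  intro h0
  have h1 := hlow (x - x) (by simp)
  rw [h0, norm_zero] at h1
  norm_num at h1
  linarith

/-- Real part of the critical-line transform of a real bump: `Re (b : ℂ)^(1/2+iw) = ∫ b(t) cos(wt) dt`. -/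
theorem re_weilMellin_ofReal_bump (b : ContDiffBump (0 : ℝ)) (w : ℝ) :
    (weilMellin (fun t => ((b t : ℝ) : ℂ)) (1 / 2 + (w : ℂ) * I)).re = ∫ t, b t * Real.cos (w * t) := by
  have hh : IsWeilTest (fun t => ((b t : ℝ) : ℂ)) :=
    ⟨Complex.ofRealCLM.contDiff.comp b.contDiff, b.hasCompactSupport.comp_left Complex.ofReal_zero⟩
  unfold weilMellin
  have hint : Integrable fun t : ℝ => ((b t : ℝ) : ℂ) * cexp ((1 / 2 + w * I - 1 / 2) * t) :=
    integrable_weilIntegrand hh.1.continuous hh.2 _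
  have hre' := integral_re hint
  simp only [RCLike.re_to_complex] at hre'
  rw [← hre']
  refine integral_congr_ae (Eventually.of_forall fun t => ?_)
  have e : (1 / 2 + (w : ℂ) * I - 1 / 2) * (t : ℂ) = ((w * t : ℝ) : ℂ) * I := by
    push_cast; ring
  simp only
  rw [e, Complex.re_ofReal_mul, Complex.exp_ofReal_mul_I_re]

/-- **Separation of points** (PROVED): for `x ≠ y` some Weil test has `ĝ(1/2+ix) ≠ ĝ(1/2+iy)`. Take a
real bump `b` of radius `δ = 1/(1+|y−x|)` (`= 1` on `[-δ/2, δ/2]`) modulated to `x`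
(`weilMellin_modulate`): its transform is `∫ b` at `x` and `∫ b(t) e^{i(y−x)t} dt` at `y`; the real part of
the difference is `∫ b(t)(1 − cos((y−x)t)) dt > 0` (`Continuous.integral_pos_of_hasCompactSupport_nonneg_nonzero`
at `t = δ/2`, where `b = 1` and `0 < |(y−x)δ/2| < 1/2 < 2π`, `Real.cos_eq_one_iff_of_lt_of_lt`). -/
theorem separation :
    ∀ x y : ℝ, x ≠ y → ∃ g : ℝ → ℂ, IsWeilTest g ∧
      weilMellin g (1 / 2 + x * I) ≠ weilMellin g (1 / 2 + y * I) := by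
  intro x y hxy
  have hv0 : y - x ≠ 0 := sub_ne_zero.2 (Ne.symm hxy)
  set δ : ℝ := 1 / (1 + |y - x|) with hδ
  have habs : 0 ≤ |y - x| := abs_nonneg _
  have hδpos : 0 < δ := by positivity
  have hvδ : |y - x| * δ < 1 := by
    rw [hδ, mul_one_div, div_lt_one (by positivity)]
    linarith
  let b : ContDiffBump (0 : ℝ) := ⟨δ / 2, δ, by positivity, by linarith⟩
  have hh : IsWeilTest (fun t => ((b t : ℝ) : ℂ)) :=
    ⟨Complex.ofRealCLM.contDiff.comp b.contDiff, b.hasCompactSupport.comp_left Complex.ofReal_zero⟩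
  refine ⟨fun t => cexp (-((x * t : ℝ) : ℂ) * I) * ((b t : ℝ) : ℂ), isWeilTest_modulate hh x, ?_⟩
  rw [weilMellin_modulate, weilMellin_modulate]
  intro heq
  have hre_eq := congrArg Complex.re heq
  rw [re_weilMellin_ofReal_bump b (x - x), re_weilMellin_ofReal_bump b (y - x)] at hre_eq
  simp only [sub_self, zero_mul, Real.cos_zero, mul_one] at hre_eq
  have hpos : 0 < ∫ t, b t * (1 - Real.cos ((y - x) * t)) := by
    refine Continuous.integral_pos_of_hasCompactSupport_nonneg_nonzero (x := δ / 2) ?_ ?_ ?_ ?_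
    · exact b.continuous.mul (continuous_const.sub (Real.continuous_cos.comp (continuous_const.mul continuous_id)))
    · exact b.hasCompactSupport.mul_right
    · intro t
      exact mul_nonneg b.nonneg (sub_nonneg.2 (Real.cos_le_one _))
    · have hb1 : b (δ / 2) = 1 := by
        apply b.one_of_mem_closedBall
        rw [Metric.mem_closedBall, dist_zero_right, Real.norm_eq_abs, abs_of_pos (half_pos hδpos)]
      rw [hb1, one_mul, sub_ne_zero]
      intro hcos
      have hlt : |(y - x) * (δ / 2)| < 2 * π := by
        rw [abs_mul, abs_of_pos (half_pos hδpos)]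
        nlinarith [Real.pi_gt_three]
      have h0 := (Real.cos_eq_one_iff_of_lt_of_lt (by linarith [(abs_lt.1 hlt).1]) (abs_lt.1 hlt).2).1
        hcos.symm
      rcases mul_eq_zero.1 h0 with h1 | h1
      · exact hv0 h1
      · linarith
  have hInt1 : Integrable (fun t : ℝ => (b t : ℝ)) :=
    b.continuous.integrable_of_hasCompactSupport b.hasCompactSupport
  have hInt2 : Integrable (fun t : ℝ => b t * Real.cos ((y - x) * t)) :=
    (b.continuous.mul (Real.continuous_cos.comp (continuous_const.mul continuous_id))).integrable_of_hasCompactSupport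
      b.hasCompactSupport.mul_right
  have hsplit : ∫ t, b t * (1 - Real.cos ((y - x) * t)) =
      (∫ t, (b t : ℝ)) - ∫ t, b t * Real.cos ((y - x) * t) := by
    rw [← integral_sub hInt1 hInt2]
    refine integral_congr_ae (Eventually.of_forall fun t => ?_)
    simp only
    ring
  rw [hsplit, ← hre_eq, sub_self] at hpos
  exact lt_irrefl _ hpos

/-! ## Sorry-free glue, II: `𝒜` is a separating *-algebra of `C₀` functions with no common zero, and
the instantiation of the abstract Stone–Weierstrass stub (gen 2) -/

/-- Membership of a transform in `𝒜`. -/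
theorem mem_lineAlgebra {g : ℝ → ℂ} (hg : IsWeilTest g) :
    (fun u : ℝ => weilMellin g (1 / 2 + u * I)) ∈ lineAlgebra :=
  ⟨g, hg, rfl⟩

/-- `𝒜 ⊆ C₀(ℝ, ℂ)`. -/
theorem lineAlgebra_c0 : ∀ f ∈ lineAlgebra, Continuous f ∧ Tendsto f (cocompact ℝ) (𝓝 0) := by
  rintro f ⟨g, hg, rfl⟩
  exact lineTransform_continuous_tendsto_zero g hg

/-- `𝒜` is closed under sums (`weilMellin_add`, `IsWeilTest.add`). -/
theorem lineAlgebra_add : ∀ f ∈ lineAlgebra, ∀ f' ∈ lineAlgebra, f + f' ∈ lineAlgebra := by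
  rintro f ⟨g, hg, rfl⟩ f' ⟨g', hg', rfl⟩
  refine ⟨g + g', hg.add hg', ?_⟩
  funext u
  simp only [Pi.add_apply]
  rw [weilMellin_add hg.1.continuous hg.2 hg'.1.continuous hg'.2]

/-- `𝒜` is closed under complex scalars (`weilMellin_const_mul`, `IsWeilTest.const_mul`). -/
theorem lineAlgebra_smul : ∀ (c : ℂ), ∀ f ∈ lineAlgebra, c • f ∈ lineAlgebra := by
  rintro c f ⟨g, hg, rfl⟩
  refine ⟨fun t => c * g t, hg.const_mul c, ?_⟩
  funext u
  simp only [Pi.smul_apply, smul_eq_mul]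
  rw [weilMellin_const_mul]

/-- `𝒜` is closed under products: convolution ↦ product (`weilMellin_weilConv_holds`, `IsWeilTest.weilConv`). -/
theorem lineAlgebra_mul : ∀ f ∈ lineAlgebra, ∀ f' ∈ lineAlgebra, f * f' ∈ lineAlgebra := by
  rintro f ⟨g, hg, rfl⟩ f' ⟨g', hg', rfl⟩
  refine ⟨weilConv g g', hg.weilConv hg', ?_⟩
  funext u
  simp only [Pi.mul_apply]
  rw [weilMellin_weilConv_holds hg.1.continuous hg.2 hg'.1.continuous hg'.2]

/-- `𝒜` is closed under `star`: reflection ↦ conjugation ON THE LINE (`weilMellin_weilReflect_half`,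
`IsWeilTest.weilReflect`). -/
theorem lineAlgebra_star : ∀ f ∈ lineAlgebra, star f ∈ lineAlgebra := by
  rintro f ⟨g, hg, rfl⟩
  refine ⟨weilReflect g, hg.weilReflect, ?_⟩
  funext u
  simp only [Pi.star_apply]
  rw [weilMellin_weilReflect_half, starRingEnd_apply]

/-- `𝒜` separates the points of `ℝ` (`separation`). -/
theorem lineAlgebra_separates : ∀ x y : ℝ, x ≠ y → ∃ f ∈ lineAlgebra, f x ≠ f y := by
  intro x y hxy
  obtain ⟨g, hg, hne⟩ := separation x y hxy
  exact ⟨_, mem_lineAlgebra hg, hne⟩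

/-- `𝒜` has no common zero (`exists_isWeilTest_weilMellin_ne_zero`). -/
theorem lineAlgebra_ne_zero : ∀ x : ℝ, ∃ f ∈ lineAlgebra, f x ≠ 0 := by
  intro x
  obtain ⟨g, hg, hne⟩ := exists_isWeilTest_weilMellin_ne_zero x
  exact ⟨_, mem_lineAlgebra hg, hne⟩

/-- **Instantiation** (gen 2): the abstract Stone–Weierstrass statement applied to `𝒜` gives the
Weil-specific `Density`. -/
theorem density_of_stoneWeierstrass (hSW : StoneWeierstrassC0) : Density := by
  intro F hF hFc ε hε
  obtain ⟨c, f, ⟨g, hg, rfl⟩, hf⟩ := hSW lineAlgebra lineAlgebra_c0 lineAlgebra_add lineAlgebra_smul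
    lineAlgebra_mul lineAlgebra_star lineAlgebra_separates lineAlgebra_ne_zero F hF hFc ε hε
  exact ⟨c, g, hg, hf⟩

/-! ### Engine checks (sorry-free): the Mathlib theorems the stubs lean on elaborate in the needed shape -/

/-- Engine of STUB 2, part 1: the zero-extension of a `C₀` function to `OnePoint ℝ`
(`coclosedCompact ℝ = cocompact ℝ`). -/
example (f : ℝ → ℂ) (hf : Continuous f) (h0 : Tendsto f (cocompact ℝ) (𝓝 0)) : C(OnePoint ℝ, ℂ) :=
  OnePoint.continuousMapMk ⟨f, hf⟩ 0 (by rw [Filter.coclosedCompact_eq_cocompact]; exact h0)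

/-- Engine of STUB 2, part 2: Stone–Weierstrass (star, `ℂ`-valued) on the compact space `OnePoint ℝ`. -/
example (A : StarSubalgebra ℂ C(OnePoint ℝ, ℂ)) (hA : A.SeparatesPoints) : A.topologicalClosure = ⊤ :=
  ContinuousMap.starSubalgebra_topologicalClosure_eq_top_of_separatesPoints A hA

/-- Engine of STUB 3 (finish): real `C_c` functions determine finite Borel measures on `ℝ`
(finite ⇒ regular on `ℝ`). -/
example (μ ν : Measure ℝ) [IsFiniteMeasure μ] [IsFiniteMeasure ν]
    (h : ∀ f : CompactlySupportedContinuousMap ℝ ℝ, ∫ x, f x ∂μ = ∫ x, f x ∂ν) : μ = ν :=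
  Measure.ext_of_integral_eq_on_compactlySupported h

/-- Engine of STUB 3 (alternative finish): bounded continuous functions determine finite Borel measures. -/
example (μ ν : Measure ℝ) [IsFiniteMeasure μ] [IsFiniteMeasure ν]
    (h : ∀ f : BoundedContinuousFunction ℝ ℝ, ∫ x, f x ∂μ = ∫ x, f x ∂ν) : μ = ν :=
  ext_of_forall_integral_eq_of_IsFiniteMeasure h

/-- Engine of STUB 1: integrals against `Measure.sum` over an ARBITRARY index type (no `Countable ι`). -/
example {ι : Type*} (m : ι → Measure ℝ) (f : ℝ → ℂ) (hf : Integrable f (Measure.sum m)) :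
    HasSum (fun i => ∫ u, f u ∂(m i)) (∫ u, f u ∂(Measure.sum m)) :=
  hasSum_integral_measure hf

/-! ## Sorry-free glue, III: atoms of the tilted measure and `RealSpectrumUnique` from the statements -/

/-- **Atom read-out**: `(Σ_i w(γ_i) δ_{γ_i}) {x} = #{i | γ_i = x} · w(x)` in `ℝ≥0∞` (the count as `encard`,
so infinite fibres are allowed a priori). -/
theorem atomicMeasure_apply_singleton {ι : Type*} (γ : ι → ℝ) (w : ℝ → ℝ≥0∞) (x : ℝ) :
    atomicMeasure γ w {x} = {i | γ i = x}.encard * w x := by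
  rw [atomicMeasure, Measure.sum_apply _ (measurableSet_singleton x)]
  have h : ∀ i, (w (γ i) • Measure.dirac (γ i)) {x} = ({i | γ i = x} : Set ι).indicator (fun _ => w x) i := by
    intro i
    rw [Measure.smul_apply, smul_eq_mul, Measure.dirac_apply' _ (measurableSet_singleton x)]
    by_cases hi : γ i = x
    · rw [Set.indicator_of_mem (show i ∈ {i | γ i = x} from hi),
        Set.indicator_of_mem (show γ i ∈ ({x} : Set ℝ) from hi), hi]
      simp
    · rw [Set.indicator_of_notMem (show i ∉ {i | γ i = x} from hi),
        Set.indicator_of_notMem (show γ i ∉ ({x} : Set ℝ) from hi)]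
      simp
  simp_rw [h]
  rw [← tsum_subtype {i | γ i = x} (fun _ => w x), ENNReal.tsum_set_const]

/-- Specialisation to the tilted spectral measure. -/
theorem weightedSpectralMeasure_apply_singleton {ι : Type*} (γ : ι → ℝ) (k : ℝ → ℂ) (x : ℝ) :
    weightedSpectralMeasure γ k {x} = {i | γ i = x}.encard * spectralWeight k x :=
  atomicMeasure_apply_singleton γ (spectralWeight k) x

/-- **The line: `RealSpectrumUnique` from the three statements.** Fix `x`; tilt by a test `k` with
`k̂(1/2+ix) ≠ 0`; the two tilted measures have equal mass and equal pairings (Pairing), hence are equal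
(MeasureExt fed with Density, itself from StoneWeierstrassC0 via the proved algebra facts); compare the
atoms at `x` and cancel the non-zero finite weight. -/
theorem realSpectrumUnique_of_line (h₁ : Pairing) (h₂ : StoneWeierstrassC0) (h₃ : MeasureExt) :
    RealSpectrumUnique := by
  intro ι ι' γ γ' L hγ hγ' x
  obtain ⟨k, hk, hkx⟩ := exists_isWeilTest_weilMellin_ne_zero x
  have hD : Density := density_of_stoneWeierstrass h₂
  obtain ⟨hmass, hpair⟩ := h₁ ι γ L hγ k hk
  obtain ⟨hmass', hpair'⟩ := h₁ ι' γ' L hγ' k hk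
  haveI : IsFiniteMeasure (weightedSpectralMeasure γ k) :=
    ⟨by rw [hmass]; exact ENNReal.ofReal_lt_top⟩
  haveI : IsFiniteMeasure (weightedSpectralMeasure γ' k) :=
    ⟨by rw [hmass']; exact ENNReal.ofReal_lt_top⟩
  have hμν : weightedSpectralMeasure γ k = weightedSpectralMeasure γ' k :=
    h₃ hD _ _ (hmass.trans hmass'.symm) fun g hg => by rw [hpair g hg, hpair' g hg]
  have hx : weightedSpectralMeasure γ k {x} = weightedSpectralMeasure γ' k {x} := by rw [hμν]
  rw [weightedSpectralMeasure_apply_singleton, weightedSpectralMeasure_apply_singleton] at hx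
  have hw0 : spectralWeight k x ≠ 0 := by
    rw [spectralWeight, Ne, ENNReal.ofReal_eq_zero, not_le]
    exact pow_pos (norm_pos_iff.2 hkx) 2
  have hwtop : spectralWeight k x ≠ ⊤ := ENNReal.ofReal_ne_top
  have h := (ENNReal.mul_left_inj hw0 hwtop).1 hx
  exact_mod_cast h

/-! ## Sorry-free glue, IV: the reduction `RealSpectrumUnique → crux` (Disproof §1–§2) -/

/-- The canonical real spectrum under RH: ordinates of the non-trivial zeros repeated with multiplicity
(the index type of `hasSum_weilMellin_zeros`). -/
def zetaOrdinates :
    (Σ ρ : ZetaZeros.riemannZetaNontrivialZeros, Fin (riemannZetaZeroOrder (ρ : ℂ)).toNat) → ℝ :=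
  fun p => (p.1 : ℂ).im

/-- Calibration: under RH the canonical family is a real spectrum of `W` (landed
`hasSum_weilMellin_zeros`, `eq_half_add_of_riemannHypothesis`). -/
theorem isRealSpectrumFor_zetaOrdinates (hRH : _root_.RiemannHypothesis) :
    IsRealSpectrumFor zetaOrdinates weilFunctional := by
  intro g hg
  simpa only [zetaOrdinates, eq_half_add_of_riemannHypothesis hRH] using hasSum_weilMellin_zeros hg

/-- Under RH the non-trivial zeros are on the critical line (unfolding Mathlib's clauses). -/
theorem re_eq_half_of_mem (hRH : _root_.RiemannHypothesis) {z : ℂ}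
    (hz : z ∈ ZetaZeros.riemannZetaNontrivialZeros) : z.re = 1 / 2 := by
  refine hRH z (ZetaZeros.riemannZetaNontrivialZeros.zeta_eq_zero hz) ?_
    (ZetaZeros.riemannZetaNontrivialZeros.ne_one hz)
  rintro ⟨n, hn⟩
  have h0 := ZetaZeros.riemannZetaNontrivialZeros.re_pos hz
  rw [hn] at h0
  simp at h0
  linarith [n.cast_nonneg (α := ℝ)]

/-- A point `1/2 + iτ` of the critical line is not the pole. -/
theorem half_add_ne_one (τ : ℝ) : (1 / 2 : ℂ) + τ * I ≠ 1 := by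
  intro h
  have := congrArg Complex.re h
  norm_num at this

/-- `m(s) = analyticOrderNatAt ζ s` for `s ≠ 1` (the explicit formula's multiplicity is the crux's). -/
theorem riemannZetaZeroOrder_eq_analyticOrderNatAt {s : ℂ} (hs : s ≠ 1) :
    riemannZetaZeroOrder s = (analyticOrderNatAt riemannZeta s : ℤ) := by
  have ha : AnalyticAt ℂ riemannZeta s := analyticOn_riemannZeta s hs
  obtain ⟨n, hn⟩ := ENat.ne_top_iff_exists.mp (analyticOrderAt_riemannZeta_ne_top hs)
  rw [riemannZetaZeroOrder, ha.meromorphicOrderAt_eq, ← hn, ENat.map_coe, WithTop.untop₀_coe,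
    analyticOrderNatAt, ← hn, ENat.toNat_coe]

/-- **Fibre count of the canonical family**, in `ℕ∞`: `#{p : Im ρ_p = τ} = 𝟙_{zeros}(1/2+iτ) · ord`. -/
theorem encard_zetaOrdinates_fibre (hRH : _root_.RiemannHypothesis) (τ : ℝ) :
    {p | zetaOrdinates p = τ}.encard =
      ZetaZeros.riemannZetaNontrivialZeros.indicator
        (fun w => (analyticOrderNatAt riemannZeta w : ℕ∞)) (1 / 2 + τ * I) := by
  set s : ℂ := 1 / 2 + τ * I with hs_def
  have hs1 : s ≠ 1 := half_add_ne_one τ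
  by_cases hz : s ∈ ZetaZeros.riemannZetaNontrivialZeros
  · have hset : {p : (Σ ρ : ZetaZeros.riemannZetaNontrivialZeros,
        Fin (riemannZetaZeroOrder (ρ : ℂ)).toNat) | zetaOrdinates p = τ} =
        Set.range (Sigma.mk (β := fun ρ : ZetaZeros.riemannZetaNontrivialZeros =>
          Fin (riemannZetaZeroOrder (ρ : ℂ)).toNat) ⟨s, hz⟩) := by
      ext p
      simp only [Set.mem_setOf_eq, Set.mem_range, zetaOrdinates]
      constructor
      · intro hp
        obtain ⟨ρ, c⟩ := p
        have hρ : ρ = ⟨s, hz⟩ := by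
          apply Subtype.ext
          have h1 := eq_half_add_of_riemannHypothesis hRH ρ
          simp only at hp
          rw [← h1, hp]
        subst hρ
        exact ⟨c, rfl⟩
      · rintro ⟨c, rfl⟩
        simp [hs_def]
    rw [hset, Set.indicator_of_mem hz, ← (Set.finite_range _).cast_ncard_eq,
      Set.ncard_range_of_injective sigma_mk_injective, Nat.card_eq_fintype_card, Fintype.card_fin]
    have h1 := riemannZetaZeroOrder_eq_analyticOrderNatAt hs1
    have h2 : (riemannZetaZeroOrder s).toNat = analyticOrderNatAt riemannZeta s := by
      rw [h1]; simp
    rw [h2]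
  · have hset : {p : (Σ ρ : ZetaZeros.riemannZetaNontrivialZeros,
        Fin (riemannZetaZeroOrder (ρ : ℂ)).toNat) | zetaOrdinates p = τ} = ∅ := by
      ext p
      simp only [Set.mem_setOf_eq, Set.mem_empty_iff_false, iff_false, zetaOrdinates]
      intro hp
      apply hz
      have h1 := eq_half_add_of_riemannHypothesis hRH p.1
      rw [hp] at h1
      rw [hs_def, h1]
      exact p.1.2
    rw [hset, Set.encard_empty, Set.indicator_of_notMem hz]

/-- **Reduction** (`RealSpectrumUnique → crux`, pointwise): RH from the hypothesis (landed
`riemannHypothesis_of_trace`); off the critical line the fibre is empty and `z` is not a non-trivial zero;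
on the line compare with the canonical family and use `encard_zetaOrdinates_fibre`. -/
theorem encard_fibre_eq_of_realSpectrumUnique (hU : RealSpectrumUnique) {ι : Type} {γ : ι → ℝ}
    (hγ : IsRealSpectrumFor γ weilFunctional) (z : ℂ) :
    {i : ι | (1 / 2 : ℂ) + (γ i : ℂ) * I = z}.encard =
      ZetaZeros.riemannZetaNontrivialZeros.indicator
        (fun w => (analyticOrderNatAt riemannZeta w : ℕ∞)) z := by
  have hRH : _root_.RiemannHypothesis := riemannHypothesis_of_trace hγ
  by_cases hre : z.re = 1 / 2
  · have hzeq : z = 1 / 2 + (z.im : ℝ) * I := by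
      apply Complex.ext <;> simp [hre]
    have hfib : {i : ι | (1 / 2 : ℂ) + (γ i : ℂ) * I = z} = {i | γ i = z.im} := by
      ext i
      simp only [Set.mem_setOf_eq]
      constructor
      · intro h
        have := congrArg Complex.im h
        simpa using this
      · intro h
        rw [hzeq]
        simp [h]
    rw [hfib, hU ι _ γ zetaOrdinates weilFunctional hγ (isRealSpectrumFor_zetaOrdinates hRH) z.im,
      encard_zetaOrdinates_fibre hRH z.im, ← hzeq]
  · have hfib : {i : ι | (1 / 2 : ℂ) + (γ i : ℂ) * I = z} = ∅ := by
      ext i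
      simp only [Set.mem_setOf_eq, Set.mem_empty_iff_false, iff_false]
      intro h
      apply hre
      have := congrArg Complex.re h
      simp at this
      rw [← this]
      norm_num
    rw [hfib, Set.encard_empty, Set.indicator_of_notMem fun hmem => hre (re_eq_half_of_mem hRH hmem)]

/-! ## The skeleton theorem -/

/-- **The line, concluding the crux BY NAME — sorry-free composition.** Logical shape
`Pairing → StoneWeierstrassC0 → MeasureExt → SpectralIsHpSpectrum` (hypotheses keyed by the registered stub
names): the statements give `RealSpectrumUnique` (`realSpectrumUnique_of_line`), and the reduction applies
it to the trace family and the canonical family of zero ordinates. -/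
theorem SpectralIsHpSpectrum_of (h₁ : Registered.stub_pairing) (h₂ : Registered.stub_stoneWeierstrass)
    (h₃ : Registered.stub_measureExt) :
    Summit.RiemannHypothesis.RiemannHypothesis.Theses.SpectralTrace.SpectralIsHpSpectrum :=
  fun _ _ hγ z => encard_fibre_eq_of_realSpectrumUnique (realSpectrumUnique_of_line h₁ h₂ h₃) hγ z

/-- Wiring check: the registered stubs feed `SpectralIsHpSpectrum_of` exactly as stated (its only gaps
are then the three `stub_*` sorries). -/
example : Summit.RiemannHypothesis.RiemannHypothesis.Theses.SpectralTrace.SpectralIsHpSpectrum :=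
  SpectralIsHpSpectrum_of stub_pairing stub_stoneWeierstrass stub_measureExt

/-! ### Checked against the landed Negative lemmas of this crux
(`Theorems/SpectralIsHpSpectrum/Negative/RefutationImpliesRH.lean`, imported): the hypothesis fed to
`stub_pairing` at the call site is the full-VALUE trace — `riemannHypothesis_of_trace` applies to it
verbatim — and not the refuted value-free weakening of `spectralIsHpSpectrum_false_without_value`; no
stub restricts the tests to a window (`spectralIsHpSpectrum_false_on_window_of_nonpos`); STUBS 2 and 3
do not mention `W` or `ζ` at all. -/

example {ι : Type} {γ : ι → ℝ} (hγ : IsRealSpectrumFor γ weilFunctional) : _root_.RiemannHypothesis :=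
  riemannHypothesis_of_trace hγ

end Summit.RiemannHypothesis.RiemannHypothesis.Cruxes.SpectralIsHpSpectrum.TestAlgebraStoneWeierstrass

end
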